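import Literature.AnabelianGeometry.EtaleTheta.Discharge.Sec2Cor218iAtModelTateChiCompat
import Literature.AnabelianGeometry.EtaleTheta.SettingModelKappaPLevelTwoOfCyclotomic
import HarnessLib

/-!
# [EtTh] Thm. 1.6 (i) / Cor. 2.18 (i) (F-0620) AT THE STAGE-2 TATE MODEL `ThetaSetting.modelχq p i 2`, FILE A (capstone):
# THE ODD-PARITY CASE IS EMPTY — `Γ(Π^tp_Ÿ) = Π^tp_Ÿ` for EVERY prime `p`, EVERY `i`, EVERY `Δ^tp_X`-stabilising `Γ`
# (proof-only; K-L6 row «THM16I-ODDPARITY-Γ@p≡3(4)»; successor item (iii) of «THM16I-NONINNER-AT-MODELTATE»)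

S. Mochizuki, *The étale theta function and its Frobenioid-theoretic manifestations* [EtTh], Publ. RIMS **45**
(2009): Thm. 1.6 (i), PRIMS p. 24 («`γ(Π^tp_{Ÿα}) = Π^tp_{Ÿβ}`») [cite: MochizukiEtTh2009, Thm 1.6 (i) p.24];
Cor. 2.18 (i), p. 60 (the named fact `RigidData.Cor218_i`, FACT-LIST F-0620) [cite: MochizukiEtTh2009, Cor 2.18(i) p.60];
§1 p. 13 («`K_N := K(ζ_N, q_X^{1/N})`»: the Galois group acts on `μ_N` through the cyclotomic character and on
`q_X^{1/N}` through the Kummer character) [cite: MochizukiEtTh2009, §1 p.13]. Classical input (consumed BY NAME from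
abc-iut-w5-d089's `SettingModelKappaPLevelTwoOfCyclotomic`): `√p ∈ ℚ_p(ζ_{4p})` resp. `√2 = ζ₈ + ζ₈⁻¹`, i.e. the Kummer
character of `p` modulo `2` factors through `χ mod 4p` [cite: IrelandRosen1990, Ch. 6 Prop 6.3.2]
[cite: NeukirchANT1999, Ch. IV §3].

abc-iut cell, layer L6 / K-L6 instance column, seat abc-iut-w6-d051 (gen 5), row «THM16I-ODDPARITY-Γ@p≡3(4)»: FILE A of
abc-iut-L6-lead's SPLIT (§F v1.19dh 2026-08-27T02:44:04Z: FILE A = this seat, FILE B = abc-iut-w4-d038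
`Sec2Cor218iAtModelTateChiCompat`, arithmetic = abc-iut-w5-d089 `SettingModelKappaPLevelTwoOfCyclotomic`, `p = 2` slice =
abc-iut-w6-d116 `Sec2Cor218iAtModelTateOddParityAtTwo`).  PROOF-ONLY (no definition, no instance, no `Prop`-valued
fact, no twin): this file is the END-KNIT, every input BY NAME —
* FILE B (abc-iut-w4-d038, p489423): `chi_right_apply_inr_eq_of_map_deltaTemp_eq` — `χ ∘ ν = χ` for the automorphism
  `ν σ := (Γ (inr σ)).right` of `G_{ℚ_p}` under any `Δ^tp_X`-stabilising `Γ`; and the JOINT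
  `map_GtpYdd_eq_of_map_deltaTemp_eq_of_level_two_kappaP_eq_of_chi_eq (hκχ)` /
  `levelHom_two_y_eq_zero_of_level_two_kappaP_eq_of_chi_eq (hκχ)` /
  `rigidData_cor218_i_modelχq_of_extends_of_level_two_kappaP_eq_of_chi_eq (hκχ)`, conditional on the binder
  `hκχ : ∀ σ τ, χ σ = χ τ → κ₂ σ = κ₂ τ`;
* arithmetic (abc-iut-w5-d089, p489409): `level_two_kappaP_eq_of_levelChar_chi_eq (hN : 4p ∣ N)` — `χ_N(σ) = χ_N(τ) ⇒
  κ₂(σ) = κ₂(τ)` for EVERY prime `p` (Gauss sums for odd `p`, `ζ₈ + ζ₈⁻¹` at `p = 2`).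
(This seat's own Gauss-sum derivation of the same arithmetic — `g = Σ (a/p) ζ_p^a`, `g² = (−1/p)·p`, `σ g = (χ_p(σ)/p)·g`,
`ε := g/√p`, `ε⁴ = 1` — reached the farm (rc 0, axioms standard) nine minutes after p489409 and is NOT filed: twin;
staged only, HOME/staging/w6/w6-d051/g5/.)

WHAT THIS FILE PROVES (numbers, not adjectives). `D = modelχq p i 2`, ANY prime `p`, ANY `i ∈ ℤ`.
§1 `level_two_kappaP_eq_of_chi_eq` — **the binder `hκχ` of FILE B is a THEOREM**: `χ(σ) = χ(τ) ⇒ κ₂(σ) = κ₂(τ)` (take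
   `N := 4p` in abc-iut-w5-d089's theorem); `level_two_kappaP_comp_eq_of_chi_comp_eq` — the `Aut(G_{ℚ_p})` shape of the
   gen-6 memo: EVERY self-map `ν` of `G_{ℚ_p}` with `χ ∘ ν = χ` has `κ₂ ∘ ν = κ₂` (no continuity, no homomorphy needed).
§2 **`map_GtpYdd_eq_of_map_deltaTemp_eq` — Thm. 1.6 (i) at `modelχq p i 2` for EVERY prime `p`, EVERY `i` and EVERY
   `Δ^tp_X`-stabilising topological automorphism `Γ`, over ANY automorphism of `G_{ℚ_p}`** (abc-iut-L6-d6's `_of_even`,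
   `_of_levelChar_four`, `_of_mod_four_eq_one`, `_of_inner_modelχq` are special cases); `level_two_kappaP_zpow_eq_right_apply_inr`
   is the level-`2` equality `κ₂(σ)^i = κ₂(ν σ)^i` it rests on.
§3 `levelHom_two_y_eq_zero_of_map_deltaTemp_eq` — THE ANSWER to item (iii): at `p ≢ 1 (mod 4)`, `i` odd, the `b`-exponent
   of `Γ(a)` is EVEN for every `Δ^tp_X`-stabilising `Γ`; NO odd-parity `Γ` exists, at any prime. The Jannsen–Wingberg /
   `Aut(G_{ℚ_p})` question feared in the memo does not arise: a `χ`-preserving automorphism of `G_{ℚ_p}` cannot move the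
   Kummer class of `p` modulo squares, because `√p` is cyclotomic.
§4 `rigidData_cor218_i_modelχq_of_extends` — F-0620 `Cor218_i` at `modelχq p i 2` (every `E`, `C`, `μ`, `hC`, `hS`, `h15`,
   empty labelling) FOLLOWS from `hextΔ` ALONE, every `p`, every `i` (gen 5's `…_of_extends_of_hgal` WITHOUT (HGAL);
   gen 6's `…_of_levelChar_four` WITHOUT `χ₄ ≡ 1`; FILE B's `…_of_level_two_kappaP_eq_of_chi_eq` WITHOUT `hκχ`).
K-L6 CONSEQUENCE (bookkeeping BY NAME, lead's call): F-0620 `Cor218_i` @ modelχq, Def1.1 → Cor1.11 @ modelTate instance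
record: residual {hextΔ, (HGAL)} (gen 5) → **{hextΔ} for EVERY prime `p`**; the «CONDITIONAL-AT-MODEL by `p mod 4`»
label of gen 6 is RETIRED.

HONEST LABEL: `modelχq` is a SEMI-SYNTHETIC model of the typed [EtTh] §1 interface (statement/model-pair evidence);
F-0620 stays a FACT-policy row; `hextΔ` is a hypothesis BY NAME ([EtTh] Prop. 2.4 shape), not endorsed; nothing of
[EtTh] (refereed) is asserted beyond the tree's proofs; no side is taken on [IUTchIII] Cor. 3.12; typed ≠ proved;
nothing here says abc is proved or refuted.
-/

noncomputable section

namespace Literature.AnabelianGeometry.EtaleTheta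

namespace SettingModel

open Literature.AnabelianGeometry.SemiGraphs Function Topology

variable (p : ℕ) [Fact p.Prime] (i : ℤ)

/-! ## §1. The arithmetic binder `hκχ` of FILE B is a theorem, every prime `p` -/

/-- The level `4p` as a positive natural. [cite: MochizukiEtTh2009, §1 p.13] -/
private theorem four_mul_pos : 0 < 4 * p := Nat.mul_pos (by norm_num) (Fact.out : p.Prime).pos

/-- **`χ(σ) = χ(τ) ⇒ κ₂(σ) = κ₂(τ)`, every prime `p`**: the Kummer character of `p` modulo `2` is a function of the
cyclotomic character (abc-iut-w5-d089's `level_two_kappaP_eq_of_levelChar_chi_eq` at `N := 4p`: `√p ∈ ℚ_p(ζ_{4p})`,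
`√2 = ζ₈ + ζ₈⁻¹`). This is the binder `hκχ` of FILE B. [cite: IrelandRosen1990, Ch. 6 Prop 6.3.2] -/
theorem level_two_kappaP_eq_of_chi_eq {σ τ : GQp p} (h : chi p σ = chi p τ) :
    ZHatLevel.level 2 (kappaP p σ) = ZHatLevel.level 2 (kappaP p τ) :=
  level_two_kappaP_eq_of_levelChar_chi_eq p (N := ⟨4 * p, four_mul_pos p⟩) (dvd_refl _) (by rw [h])

/-- **Every `χ`-preserving self-map of `G_{ℚ_p}` preserves `κ_p mod 2`** — the `Aut(G_{ℚ_p})` shape in which the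
gen-6 memo posed item (iii) («`ν ∈ Aut_top(G_{ℚ_p})`, `χ ∘ ν = χ`, with `[κ_p ∘ ν] − u·[κ_p]` an odd multiple of
`[κ_{−1}]`»: no such `ν` exists; neither continuity nor multiplicativity of `ν` is needed). [cite: IrelandRosen1990, Ch. 6 Prop 6.3.2] -/
theorem level_two_kappaP_comp_eq_of_chi_comp_eq (ν : GQp p → GQp p) (hν : ∀ σ, chi p (ν σ) = chi p σ)
    (σ : GQp p) : ZHatLevel.level 2 (kappaP p (ν σ)) = ZHatLevel.level 2 (kappaP p σ) :=
  level_two_kappaP_eq_of_chi_eq p (hν σ)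

/-! ## §2. Thm. 1.6 (i) at `modelχq p i 2`: every `p`, every `i`, every `Δ`-stabilising `Γ` -/

/-- **`κ₂(σ)^i = κ₂(ν σ)^i` for every `Δ^tp_X`-stabilising `Γ`** (FILE B: `ν` preserves `χ`; §1: `κ₂` is a function of
`χ`) — the `hlev` input of abc-iut-L6-d6's `apply_mem_GtpYdd_of_level_two_eq`. [cite: MochizukiEtTh2009, Thm 1.6 (i) p.24] -/
theorem level_two_kappaP_zpow_eq_right_apply_inr (Γ : PiTpχq p i 2 ≃ₜ* PiTpχq p i 2)
    (hΔ : (curveχq p i 2).DeltaTemp.map Γ.toMulEquiv.toMonoidHom = (curveχq p i 2).DeltaTemp) (σ : GQp p) :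
    ZHatLevel.level 2 (kappaP p σ ^ i) = ZHatLevel.level 2 (kappaP p (Γ (SemidirectProduct.inr σ)).right ^ i) := by
  rw [map_zpow, map_zpow,
    level_two_kappaP_eq_of_chi_eq p (chi_right_apply_inr_eq_of_map_deltaTemp_eq p i Γ hΔ σ).symm]

/-- **Thm. 1.6 (i) at the stage-2 Tate model, UNCONDITIONALLY IN `p`, `i` AND `ν`: every `Δ^tp_X`-stabilising
topological automorphism `Γ` of `Π^tp_X(modelχq p i 2)` maps `Π^tp_Ÿ` ONTO itself** — over ANY (possibly non-inner)
automorphism of `G_{ℚ_p}`; FILE B's JOINT with its binder `hκχ` DISCHARGED by §1. abc-iut-L6-d6's `_of_even` /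
`_of_levelChar_four` / `_of_mod_four_eq_one` / `_of_inner_modelχq` are special cases. [cite: MochizukiEtTh2009, Thm 1.6 (i) p.24] -/
theorem map_GtpYdd_eq_of_map_deltaTemp_eq (Γ : PiTpχq p i 2 ≃ₜ* PiTpχq p i 2)
    (hΔ : (curveχq p i 2).DeltaTemp.map Γ.toMulEquiv.toMonoidHom = (curveχq p i 2).DeltaTemp) :
    (ThetaSetting.modelχq p i 2 even_two).GtpYdd.map Γ.toMulEquiv.toMonoidHom =
      (ThetaSetting.modelχq p i 2 even_two).GtpYdd :=
  map_GtpYdd_eq_of_map_deltaTemp_eq_of_level_two_kappaP_eq_of_chi_eq p i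
    (fun _ _ h => level_two_kappaP_eq_of_chi_eq p h) Γ hΔ

/-! ## §3. The answer to item (iii): no `Δ`-stabilising `Γ` of odd parity exists, at any prime -/

/-- **The `b`-exponent of `Γ(a)` is EVEN for every `Δ^tp_X`-stabilising `Γ` at `p ≢ 1 (mod 4)`, `i` odd** (⊇ the shape
of the instance of record `(i, j) = (1, 2)`): abc-iut-L6-d6's criterion `map_GtpYdd_eq_iff_levelHom_two_y_eq_zero` read
backwards through §2 (FILE B's `levelHom_two_y_eq_zero_of_level_two_kappaP_eq_of_chi_eq` with `hκχ` discharged). So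
item (iii) of the memo («does a `Δ`-stabilising `Γ` with odd `b`-parity of `Γ(a)` exist at `p ≡ 3 (mod 4)`?») has the
kernel answer NO. [cite: MochizukiEtTh2009, Thm 1.6 (i) p.24] -/
theorem levelHom_two_y_eq_zero_of_map_deltaTemp_eq (hi : Odd i) (hp : p % 4 ≠ 1)
    (Γ : PiTpχq p i 2 ≃ₜ* PiTpχq p i 2)
    (hΔ : (curveχq p i 2).DeltaTemp.map Γ.toMulEquiv.toMonoidHom = (curveχq p i 2).DeltaTemp) :
    (levelHom 2 (Γ (SemidirectProduct.inl (gfpOf (FreeGroup.of 0)))).left).y = 0 :=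
  levelHom_two_y_eq_zero_of_level_two_kappaP_eq_of_chi_eq p i hi hp
    (fun _ _ h => level_two_kappaP_eq_of_chi_eq p h) Γ hΔ

/-- Equivalently: at `p ≢ 1 (mod 4)`, `i` odd, there is NO `Δ^tp_X`-stabilising topological automorphism of
`Π^tp_X(modelχq p i 2)` whose `Γ(a)` has odd `b`-exponent. [cite: MochizukiEtTh2009, Thm 1.6 (i) p.24] -/
theorem not_exists_map_deltaTemp_eq_and_levelHom_two_y_ne_zero (hi : Odd i) (hp : p % 4 ≠ 1) :
    ¬ ∃ Γ : PiTpχq p i 2 ≃ₜ* PiTpχq p i 2,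
      (curveχq p i 2).DeltaTemp.map Γ.toMulEquiv.toMonoidHom = (curveχq p i 2).DeltaTemp ∧
        (levelHom 2 (Γ (SemidirectProduct.inl (gfpOf (FreeGroup.of 0)))).left).y ≠ 0 :=
  fun ⟨Γ, hΔ, hy⟩ => hy (levelHom_two_y_eq_zero_of_map_deltaTemp_eq p i hi hp Γ hΔ)

/-! ## §4. F-0620 `Cor218_i` at the record's shape FROM the extension property ALONE, every `p`, every `i` -/

/-- **F-0620 `Cor218_i` at `modelχq p i 2`, for every étale-theta datum `E`, every `X̲̲`-choice `C`, every level `μ`, `hC`,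
`hS`, `h15` and the EMPTY cusp labelling, FROM `hextΔ` ALONE — every prime `p`, every `i`** (gen 5's
`rigidData_cor218_i_modelχq_of_extends_of_hgal` WITHOUT (HGAL); gen 6's `…_of_levelChar_four` WITHOUT `χ₄ ≡ 1`; FILE B's
`…_of_level_two_kappaP_eq_of_chi_eq` with `hκχ` DISCHARGED by §1). CONDITIONAL-AT-MODEL on `hextΔ` only: F-0620@instance
is NOT decided. [cite: MochizukiEtTh2009, Cor 2.18(i) p.60] -/
theorem rigidData_cor218_i_modelχq_of_extends
    {E : (ThetaSetting.modelχq p i 2 even_two).EtaleThetaData} {l : ℕ} (C : E.DoubleUnderline l) {N : ℕ+}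
    (μ : (ThetaSetting.modelχq p i 2 even_two).CyclotomeMod l N) (hC : (ThetaSetting.modelχq p i 2 even_two).Compat)
    (hS : (ThetaSetting.modelχq p i 2 even_two).Sec2Hyps) (h15 : ThetaSetting.Prop15iii E hC)
    (hext : ∀ γ : ↥C.Huu ≃ₜ* ↥C.Huu, ∃ Γ : PiTpχq p i 2 ≃ₜ* PiTpχq p i 2,
      (∀ h : C.Huu, Γ (h : PiTpχq p i 2) = ((γ h : C.Huu) : PiTpχq p i 2)) ∧
        (curveχq p i 2).DeltaTemp.map Γ.toMulEquiv.toMonoidHom = (curveχq p i 2).DeltaTemp) :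
    (C.rigidData μ hC hS h15 ⟨fun _ => ∅, fun _ => ∅, fun _ => rfl⟩).Cor218_i :=
  rigidData_cor218_i_modelχq_of_extends_of_level_two_kappaP_eq_of_chi_eq p i
    (fun _ _ h => level_two_kappaP_eq_of_chi_eq p h) C μ hC hS h15 hext

end SettingModel

end Literature.AnabelianGeometry.EtaleTheta

end
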